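import Mathlib
import Summits.ResolutionOfSingularities.ResolutionOfSingularities.Theorems.RadicialJungCleanModelsLens5TFrameSepCurrency
import HarnessLib

/-!
# Route `RadicialJung`, crux `CleanModels` (stmt-15917): T″ port part 1/10 — Mac Lane's separable bridge, `p`-basis families, uptake glue `cleanLUConcl_of_sepRes`, residue field algebraic under `hzd` (source `Lens5_TPrimeInfCurrency.lean` §I/§J/§K)

PORT (line lead `res-B-lead-1` g8, for Sketch rev 33) of res-B-lens-5's crux workfiles `Cruxes/DescentPerfectToAll/Lens5_TPrimeInfCurrency.lean` rev 4
(crux 75ffdaa75b27; author res-B-lens-5 g14), the T″ theorem module prepared by the author from `Lens5_TPrimeInf.lean` rev 3 (HOME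
`B/res-B-lens-5/g14/PORTALPHA_TPrimeInf_theorem_module.lean`, sha16 48c5cb0bf6ec7b34, certified by the author's one-file simulation) and
`Cruxes/DescentPerfectToAll/Lens5_TPrimeConst.lean` rev 1 (4e5e6a0028c2): THEOREMS T′_∞ / T″ / T‴ — the slice {`[Γ:pΓ] = p²`, `K/k′` separably
generated and `κ_v/k′` SEPARABLE for some finite intermediate field of constants `k ⊆ k′ ⊆ K`} of the research stub `stub_cleanLU3DefectNonDiscrete`
(grounds of ARBITRARY, possibly infinite, `p`-rank), modulo F-02 `CossartPiltant2019` and F-32 (`hEmb`) only.  Continues the T⁗-family port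
(`…Lens5TFrame{Currency,…,PDegreeC}`): same namespace `Summit.ResolutionOfSingularities.ResolutionOfSingularities.Theorems.RadicialJungCleanModels.Lens5TFrame`,
declarations VERBATIM; the authors' copies of §B/§B′ (defs) and §C/§D (RG/IR lemmas) are NOT repeated — they are the landed `…Lens5TFrameCurrency` /
`…Lens5TFrameRG` / `…Lens5TFrameIR` declarations of the same names and statements; §C′/§B‴ (unused bridges) and the T′_fin/T′₁/«T″ ⊇ T» corollaries are not ported.
OURS · counted 0 · nothing here proves resolution in characteristic `p`.


-/

set_option linter.dupNamespace false -- mandated namespace of this single-conjunct summit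

noncomputable section

section

open IsLocalRing
open Literature.AlgebraicGeometry.Resolution
open Summit.ResolutionOfSingularities.ResolutionOfSingularities.Theorems.RadicialJung.CleanModels
open Summit.ResolutionOfSingularities.ResolutionOfSingularities.Theorems.RadicialJung.CleanModels.Lens5
open Summit.ResolutionOfSingularities.ResolutionOfSingularities.Theorems.RadicialJung.CleanModels.Lens5.PRankTwoCurrency
open Summit.ResolutionOfSingularities.ResolutionOfSingularities.Theorems.RadicialJung.CleanModels.Lens5.PRankTwoAssembly
open Summit.ResolutionOfSingularities.ResolutionOfSingularities.Theorems.RadicialJungCleanModels.Lens5RegularityCriterion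
open Summit.ResolutionOfSingularities.ResolutionOfSingularities.Theorems.RadicialJungCleanModels.Lens5ChartSurjection

namespace Summit.ResolutionOfSingularities.ResolutionOfSingularities.Theorems.RadicialJungCleanModels.Lens5TFrame

/-! ## §I (rev 2) THEOREM T″ — the slice stated with «`κ_v/k` SEPARABLE» (Mathlib's `Algebra.IsSeparable`) in place of the family `b`

Bridge B1 (Mac Lane 1939, separable direction) IN KERNEL: if the residue field `κ_v = O/𝔪_v` is separable over `k` (for ANY `k`-algebra
structure on `κ_v` compatible with `k → O → κ_v`), then EVERY `k^p`-linearly independent family of constants is residually `p`-independent along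
`v` (§B″ (RPI∞)); the proof is Mathlib's linear disjointness of a separable and a purely inseparable extension
(`IntermediateField.linearDisjoint_of_isPurelyInseparable_of_isSeparable`, applied to `κ_v^p ⊇ k^p` separable and `k ⊇ k^p` purely inseparable
inside `κ_v`, after transporting `κ_v/k` to `κ_v^p/k^p` along the two Frobenius isomorphisms).  Since every field has a `k^p`-basis
(`exists_pBasisFamilyInf`), T′_∞ yields **T″**: `stub_cleanLU3DefectNonDiscrete` on {(P2)} × {`K/k` separably generated} × {`κ_v/k` separable},
with NO auxiliary family in the statement. -/

/-- **Mac Lane's criterion, separable direction (elementary form).**  If `κ/k` is a separable field extension in characteristic `p` and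
`b : S → k` is `k^p`-linearly independent (no non-trivial relation `Σ d_s^p b_s = 0` in `k`), then the images of the `b_s` in `κ` are
`κ^p`-linearly independent (no non-trivial relation `Σ e_s^p b_s = 0` in `κ`).  [MacLane 1939, Thm. 11; Mathlib linear disjointness] -/
theorem pow_linearIndependent_of_isSeparable (p : ℕ) [Fact p.Prime] {k κ : Type} [Field k] [CharP k p] [Field κ] [Algebra k κ]
    [Algebra.IsSeparable k κ] {S : Type} (b : S → k)
    (hbli : ∀ (s₀ : Finset S) (d : S → k), ∑ i ∈ s₀, d i ^ p * b i = 0 → ∀ i ∈ s₀, d i = 0)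
    (s₀ : Finset S) (e : S → κ) (he : ∑ i ∈ s₀, e i ^ p * algebraMap k κ (b i) = 0) : ∀ i ∈ s₀, e i = 0 := by
  classical
  have hp : p.Prime := Fact.out
  haveI : ExpChar k p := ExpChar.prime hp
  haveI : CharP κ p := ((algebraMap k κ).charP_iff_charP p).mp inferInstance
  haveI : ExpChar κ p := ExpChar.prime hp
  -- ## the small field `F = k^p ⊆ k` and the tower `F → k → κ` (canonical `Subfield` instances)
  set F : Subfield k := (frobenius k p).fieldRange with hFdef
  haveI : CharP F p := ((algebraMap F k).charP_iff_charP p).mpr inferInstance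
  haveI : ExpChar F p := ExpChar.prime hp
  have halgF : ∀ x : F, algebraMap F κ x = algebraMap k κ (x : k) := fun _ => rfl
  -- ## `k/F` is purely inseparable (of height one)
  haveI : IsPurelyInseparable F k := by
    rw [isPurelyInseparable_iff_pow_mem F p]
    intro x
    refine ⟨1, ⟨⟨x ^ p, RingHom.mem_fieldRange.mpr ⟨x, frobenius_def _ _⟩⟩, ?_⟩⟩
    rw [pow_one]; rfl
  -- ## `κ^p` as an intermediate field of `κ/F`
  have hmemSp : ∀ x : F, algebraMap F κ x ∈ (frobenius κ p).fieldRange := fun x => by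
    obtain ⟨c, hc⟩ := RingHom.mem_fieldRange.mp x.2
    refine RingHom.mem_fieldRange.mpr ⟨algebraMap k κ c, ?_⟩
    rw [frobenius_def, ← map_pow, ← frobenius_def, hc, halgF]
  let Sp : IntermediateField F κ := ((frobenius κ p).fieldRange).toIntermediateField hmemSp
  have hmemSp_iff : ∀ y : κ, y ∈ Sp ↔ y ∈ (frobenius κ p).fieldRange := fun _ => Iff.rfl
  -- ## `Sp/F` is separable: transport `κ/k` along the two Frobenius isomorphisms `k ≃ F`, `κ ≃ Sp`
  haveI : Algebra.IsSeparable F Sp := by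
    let φ₁ : k →+* F := (frobenius k p).codRestrict F (fun x => RingHom.mem_fieldRange.mpr ⟨x, rfl⟩)
    have hφ₁ : Function.Bijective φ₁ := by
      refine ⟨φ₁.injective, fun y => ?_⟩
      obtain ⟨x, hx⟩ := RingHom.mem_fieldRange.mp y.2
      exact ⟨x, Subtype.ext hx⟩
    let e₁ : k ≃+* F := RingEquiv.ofBijective φ₁ hφ₁
    let φ₂ : κ →+* Sp := (frobenius κ p).codRestrict Sp (fun y => (hmemSp_iff _).mpr (RingHom.mem_fieldRange.mpr ⟨y, rfl⟩))
    have hφ₂ : Function.Bijective φ₂ := by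
      refine ⟨φ₂.injective, fun y => ?_⟩
      obtain ⟨x, hx⟩ := RingHom.mem_fieldRange.mp ((hmemSp_iff _).mp y.2)
      exact ⟨x, Subtype.ext hx⟩
    let e₂ : κ ≃+* Sp := RingEquiv.ofBijective φ₂ hφ₂
    have he : (algebraMap F Sp).comp (e₁ : k →+* F) = (e₂ : κ →+* Sp).comp (algebraMap k κ) := by
      ext c
      show algebraMap F κ (φ₁ c) = (φ₂ (algebraMap k κ c) : κ)
      rw [halgF]
      show algebraMap k κ (frobenius k p c) = frobenius κ p (algebraMap k κ c)
      rw [frobenius_def, frobenius_def, map_pow]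
    exact Algebra.IsSeparable.of_equiv_equiv e₁ e₂ he
  -- ## linear disjointness (Mathlib) and the transfer of linear independence from `F` to `Sp = κ^p`
  have H : Sp.LinearDisjoint k := IntermediateField.linearDisjoint_of_isPurelyInseparable_of_isSeparable (E := k) Sp
  have hbF : LinearIndependent F b := by
    rw [linearIndependent_iff']
    intro s g hg i hi
    have hroot : ∀ j, ∃ d : k, d ^ p = (g j : k) := fun j => by
      obtain ⟨d, hd⟩ := RingHom.mem_fieldRange.mp (g j).2
      exact ⟨d, by rw [← hd, frobenius_def]⟩
    choose d hd using hroot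
    have hrel : ∑ j ∈ s, d j ^ p * b j = 0 := by
      rw [← hg]
      exact Finset.sum_congr rfl fun j _ => by rw [hd, Subfield.smul_def, smul_eq_mul]
    have := hbli s d hrel i hi
    apply Subtype.ext
    rw [← hd i, this, zero_pow hp.ne_zero]; rfl
  have hbSp : LinearIndependent Sp (algebraMap k κ ∘ b) := H.linearIndependent_right' hbF
  -- ## read off the elementary statement
  intro i hi
  rw [linearIndependent_iff'] at hbSp
  let g : S → Sp := fun j => ⟨e j ^ p, (hmemSp_iff _).mpr (RingHom.mem_fieldRange.mpr ⟨e j, frobenius_def _ _⟩)⟩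
  have hg : ∑ j ∈ s₀, g j • (algebraMap k κ ∘ b) j = 0 := by
    rw [← he]
    exact Finset.sum_congr rfl fun j _ => by rw [IntermediateField.smul_def, smul_eq_mul]; rfl
  have h2 : e i ^ p = 0 := congrArg Subtype.val (hbSp s₀ g hg i hi)
  exact (pow_eq_zero_iff hp.ne_zero).mp h2

/-- **Bridge B1 (Mac Lane), separable direction, along a valuation.**  Let the constants be `v`-integral (`hk`) and let `κ_v = O/𝔪_v` carry
ANY `k`-algebra structure compatible with `k → O → κ_v` (`hcomp`).  If `κ_v/k` is SEPARABLE, then every `k^p`-linearly independent family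
`b` of constants is residually `p`-independent along `v` (§B″ (RPI∞)): a relation `Σ w_s^p b_s ∈ 𝔪_v` with some `w_s` a unit would reduce to a
non-trivial `κ_v^p`-relation among the `b̄_s`, excluded by `pow_linearIndependent_of_isSeparable`. [MacLane 1939; folklore] -/
theorem residuallyPIndependentFamilyInf_of_isSeparable (p : ℕ) [Fact p.Prime] {k K : Type} [Field k] [CharP k p]
    [Field K] [Algebra k K] (O : ValuationSubring K) (hk : ∀ c : k, algebraMap k K c ∈ O)
    [Algebra k (IsLocalRing.ResidueField O)]
    (hcomp : ∀ (c : k) (h : algebraMap k K c ∈ O),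
      algebraMap k (IsLocalRing.ResidueField O) c = IsLocalRing.residue O ⟨algebraMap k K c, h⟩)
    [Algebra.IsSeparable k (IsLocalRing.ResidueField O)]
    {S : Type} (b : S → k)
    (hbli : ∀ (s₀ : Finset S) (d : S → k), ∑ i ∈ s₀, d i ^ p * b i = 0 → ∀ i ∈ s₀, d i = 0) :
    ResiduallyPIndependentFamilyInf p O (fun s => algebraMap k K (b s)) := by
  classical
  intro s₀ w hw hw1
  let wO : S → O := fun j => ⟨w j, hw j⟩
  let BO : S → O := fun j => ⟨algebraMap k K (b j), hk (b j)⟩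
  set xO : O := ∑ j ∈ s₀, wO j ^ p * BO j with hxOdef
  have hx : (xO : K) = ∑ j ∈ s₀, w j ^ p * algebraMap k K (b j) := by
    rw [hxOdef]; push_cast; rfl
  have hle : O.valuation (∑ j ∈ s₀, w j ^ p * algebraMap k K (b j)) ≤ 1 := by
    rw [← hx]; exact (O.valuation_le_one_iff _).mpr xO.2
  by_contra hne
  have hlt : O.valuation (∑ j ∈ s₀, w j ^ p * algebraMap k K (b j)) < 1 := lt_of_le_of_ne hle hne
  rw [← hx, ← O.valuation_lt_one_iff] at hlt
  have hres : IsLocalRing.residue O xO = 0 := (IsLocalRing.residue_eq_zero_iff _).mpr hlt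
  have hsum : ∑ j ∈ s₀, IsLocalRing.residue O (wO j) ^ p * algebraMap k (IsLocalRing.ResidueField O) (b j) = 0 := by
    rw [← hres, hxOdef, map_sum]
    exact Finset.sum_congr rfl fun j _ => by rw [map_mul, map_pow, hcomp (b j) (hk (b j))]
  have hall := pow_linearIndependent_of_isSeparable p b hbli s₀ (fun j => IsLocalRing.residue O (wO j)) hsum
  obtain ⟨i, hi, hvi⟩ := hw1
  have hmax : wO i ∈ IsLocalRing.maximalIdeal O := (IsLocalRing.residue_eq_zero_iff _).mp (hall i hi)
  have hlt1 : O.valuation (w i) < 1 := (O.valuation_lt_one_iff _).mp hmax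
  exact absurd hvi hlt1.ne

/-- **Every field of characteristic `p` has a `k^p`-basis**, i.e. a family `b` which is `p`-spanning with finitely supported sums (§B″ (SPAN∞))
AND `k^p`-linearly independent (`Module.Free.chooseBasis` over the subfield `k^p`). [folklore] -/
theorem exists_pBasisFamilyInf (p : ℕ) [Fact p.Prime] (k : Type) [Field k] [CharP k p] :
    ∃ (S : Type) (b : S → k), IsPSpanningFamilyInf p b ∧
      ∀ (s₀ : Finset S) (d : S → k), ∑ i ∈ s₀, d i ^ p * b i = 0 → ∀ i ∈ s₀, d i = 0 := by
  classical
  have hp : p.Prime := Fact.out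
  let kp : Subfield k := (frobenius k p).fieldRange
  let B := Module.Free.chooseBasis kp k
  have hroot : ∀ x : kp, ∃ d : k, d ^ p = (x : k) := fun x => by
    obtain ⟨d, hd⟩ := RingHom.mem_fieldRange.mp x.2
    exact ⟨d, by rw [← hd, frobenius_def]⟩
  choose rt hrt using hroot
  refine ⟨Module.Free.ChooseBasisIndex kp k, fun i => B i,
    fun c => ⟨(B.repr c).support, fun i => rt (B.repr c i), ?_⟩, fun s₀ d hd i hi => ?_⟩
  · conv_lhs => rw [← B.linearCombination_repr c, Finsupp.linearCombination_apply, Finsupp.sum]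
    refine Finset.sum_congr rfl fun i _ => ?_
    rw [hrt, Subfield.smul_def, smul_eq_mul]
  · have hli := B.linearIndependent
    rw [linearIndependent_iff'] at hli
    let g : Module.Free.ChooseBasisIndex kp k → kp := fun j => ⟨d j ^ p, RingHom.mem_fieldRange.mpr ⟨d j, frobenius_def _ _⟩⟩
    have hg : ∑ j ∈ s₀, g j • B j = 0 := by
      rw [← hd]
      exact Finset.sum_congr rfl fun j _ => by rw [Subfield.smul_def, smul_eq_mul]
    have h2 : d i ^ p = 0 := congrArg Subtype.val (hli s₀ g hg i hi)
    exact (pow_eq_zero_iff hp.ne_zero).mp h2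


/-- **T″ ⊂ T′_∞**: over ANY ground field, «`κ_v/k` separable» supplies T′_∞'s family — a `k^p`-basis of `k` (`exists_pBasisFamilyInf`),
residually `p`-independent by Bridge B1 (`residuallyPIndependentFamilyInf_of_isSeparable`). [folklore] -/
theorem cleanLU3DefectPRankTwoSepRes_of_sepInf (p : ℕ) [Fact p.Prime] (hInf : CleanLU3DefectPRankTwoSepInfAt p) :
    CleanLU3DefectPRankTwoSepResAt p := by
  intro k _ _ K _ _ O A hAO hAfg hFrac hdimA hreg hdim3 hzd g₀ hg₀ hdefect htd hnd hP2 hsep _ hcomp hks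
  have hk : ∀ c : k, algebraMap k K c ∈ O := fun c => hAO (A.algebraMap_mem c)
  obtain ⟨S, b, hb, hbli⟩ := exists_pBasisFamilyInf p k
  exact hInf k K O A hAO hAfg hFrac hdimA hreg hdim3 hzd g₀ hg₀ hdefect htd hnd hP2 hsep S b hb
    (residuallyPIndependentFamilyInf_of_isSeparable p O hk hcomp b hbli)

/-! ## §J (rev 3) UPTAKE: the ∃-form of T″ for the lead's `by_cases` in `cleanLU3DefectNonDiscrete_of_stubs`, and (SEP-K) automatic over a perfect
ground field (Mathlib `exists_isTranscendenceBasis_and_isSeparable_of_perfectField`), so that T″ ⊇ T EXACTLY whenever `κ_v/k` is separable algebraic -/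

/-- **Uptake form of T″.**  The binders of `stub_cleanLU3DefectNonDiscrete` (Sketch rev 28 :279) up to `¬ (discrete of rank one)`, then the POSITIVE side
condition «`[Γ:pΓ] = p²` ∧ `K/k` separably generated ∧ `κ_v/k` separable for SOME `k`-algebra structure on `κ_v` compatible with `k → O → κ_v`» (the
negation of the proposed fifth negated hypothesis of a rev-29 cut), give the conclusion.  Template for the lead's new `by_cases` branch:
`· haveI : Fact p.Prime := ⟨hp⟩; exact cleanLUConcl_of_sepRes p (cleanLU3DefectPRankTwoSepRes_of_cossartPiltant2019 p stub_cossartPiltant2019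
stub_cjs2020Cor15) k K O A hAO hAfg hfrac hdimA hreg hdim3 hzd g₀ hg₀ hdefect htd hdisc h5`. [folklore] -/
theorem cleanLUConcl_of_sepRes (p : ℕ) (hT : CleanLU3DefectPRankTwoSepResAt p)
    (k : Type) [Field k] [CharP k p] (K : Type) [Field K] [Algebra k K]
    (O : ValuationSubring K) (A : Subalgebra k K) (hAO : A.toSubring ≤ O.toSubring) (hAfg : A.FG) (hFrac : IsFractionRing A K)
    (hdimA : ringKrullDim A ≤ 3) (hreg : IsRegularLocalRing (locAtCentre A.toSubring O))
    (hdim3 : ringKrullDim (locAtCentre A.toSubring O) = 3)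
    (hzd : ∀ (T : Subring K) (hT : T ≤ O.toSubring), A.toSubring ≤ T → (subringCentre T O hT).IsMaximal)
    (g₀ : K) (hg₀ : ∀ c : K, c ^ p ≠ g₀)
    (hdefect : ∀ f₀ : K, ∃ f₁ : K, O.valuation (g₀ - f₁ ^ p) < O.valuation (g₀ - f₀ ^ p))
    (htd : ∀ hk : ∀ c : k, algebraMap k K c ∈ O, transcendenceDefect k O hk ≠ 0)
    (hnd : ¬ (∃ π : K, π ≠ 0 ∧ (∀ x : K, O.valuation x < 1 → O.valuation x ≤ O.valuation π) ∧
      (∀ x : K, x ≠ 0 → ∃ n : ℕ, O.valuation π ^ n ≤ O.valuation x)))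
    (h5 : PRankTwoAt p O ∧ SepGenerated k K ∧ ∃ _ : Algebra k (IsLocalRing.ResidueField O),
      (∀ (c : k) (h : algebraMap k K c ∈ O),
        algebraMap k (IsLocalRing.ResidueField O) c = IsLocalRing.residue O ⟨algebraMap k K c, h⟩) ∧
      Algebra.IsSeparable k (IsLocalRing.ResidueField O)) :
    CleanLUConcl p k K O A g₀ := by
  obtain ⟨hP2, hsep, inst, hcomp, hks⟩ := h5
  exact hT k K O A hAO hAfg hFrac hdimA hreg hdim3 hzd g₀ hg₀ hdefect htd hnd hP2 hsep hcomp hks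

/-- **(SEP-K) is automatic over a PERFECT ground field** for `K = Frac A`, `A` of finite type over `k` (Mathlib: a finitely generated extension of a perfect
field is separably generated, `exists_isTranscendenceBasis_and_isSeparable_of_perfectField`; re-indexed to the census def `SepGenerated`). [folklore] -/
theorem sepGenerated_of_perfectField {k K : Type} [Field k] [PerfectField k] [Field K] [Algebra k K]
    (A : Subalgebra k K) (hAfg : A.FG) (hFrac : IsFractionRing A K) : SepGenerated k K := by
  classical
  haveI : Algebra.FiniteType k A := (Subalgebra.fg_iff_finiteType A).mp hAfg
  haveI : Algebra.EssFiniteType A K := Algebra.EssFiniteType.of_isLocalization (R := A) (S := K) (nonZeroDivisors A)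
  haveI : Algebra.EssFiniteType k K := Algebra.EssFiniteType.comp k A K
  obtain ⟨s, hs, hsepK⟩ := exists_isTranscendenceBasis_and_isSeparable_of_perfectField k K
  have hrange : Set.range (fun i : Fin s.card => ((s.equivFin.symm i : s) : K)) = (s : Set K) := by
    ext x
    constructor
    · rintro ⟨i, rfl⟩
      exact (s.equivFin.symm i).2
    · intro hx
      exact ⟨s.equivFin ⟨x, hx⟩, by simp only [Equiv.symm_apply_apply]⟩
  refine ⟨s.card, fun i => ((s.equivFin.symm i : s) : K), hs.1.comp _ s.equivFin.symm.injective, ?_⟩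
  rw [hrange]
  exact hsepK

/-! ## §K (rev 4) THE RESIDUE FIELD IS ALGEBRAIC IN THE :279 REGIME (Zariski's lemma on every model), HENCE T″ ⊇ T IN KERNEL -/

/-- **Zero-dimensional valuations have algebraic residue field.**  If the centre of `v` on EVERY finite-type model `T ⊇ A` of `K/k` inside `O_v` is a
maximal ideal (the :279 hypothesis `hzd`), then every residue class `ō ∈ κ_v` of an `o ∈ O_v` is integral over `k` (apply `hzd` to `T := A[o]`; `T/𝔠`
is a field of finite type over `k`, hence algebraic by Zariski's lemma — Mathlib `MvPolynomial.comp_C_integral_of_surjective_of_isJacobsonRing`; and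
`T/𝔠 ↪ κ_v`).  The `k`-algebra structure on `κ_v` is any one compatible with `k → O_v → κ_v`. [folklore] -/
theorem residue_isIntegral_of_centres_maximal {k K : Type} [Field k] [Field K] [Algebra k K]
    (O : ValuationSubring K) (A : Subalgebra k K) (hAO : A.toSubring ≤ O.toSubring) (hAfg : A.FG)
    (hzd : ∀ (T : Subring K) (hT : T ≤ O.toSubring), A.toSubring ≤ T → (subringCentre T O hT).IsMaximal)
    [Algebra k (IsLocalRing.ResidueField O)]
    (hcomp : ∀ (c : k) (h : algebraMap k K c ∈ O),
      algebraMap k (IsLocalRing.ResidueField O) c = IsLocalRing.residue O ⟨algebraMap k K c, h⟩)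
    (o : K) (ho : o ∈ O) : IsIntegral k (IsLocalRing.residue O ⟨o, ho⟩) := by
  classical
  have hk : ∀ c : k, algebraMap k K c ∈ O := fun c => hAO (A.algebraMap_mem c)
  obtain ⟨s, hs⟩ := hAfg
  -- the model `T := k[s, o] = A[o]`
  let σ : Finset K := insert o s
  let v : ↥σ → K := fun x => (x : K)
  let T' : Subalgebra k K := Algebra.adjoin k (σ : Set K)
  have hrange : Set.range v = (σ : Set K) := by
    ext x
    constructor
    · rintro ⟨i, rfl⟩
      exact i.2
    · intro hx
      exact ⟨⟨x, hx⟩, rfl⟩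
  have hT'eq : T' = (MvPolynomial.aeval (R := k) v).range := by
    show Algebra.adjoin k (σ : Set K) = _
    rw [← hrange]
    exact Algebra.adjoin_range_eq_range_aeval k v
  -- `T' ⊆ O`
  let OA : Subalgebra k K :=
    { O.toSubring with
      algebraMap_mem' := fun c => hk c }
  have hσO : (σ : Set K) ⊆ (OA : Set K) := by
    intro x hx
    rcases Finset.mem_insert.mp (Finset.mem_coe.mp hx) with rfl | hx'
    · exact ho
    · exact hAO (show x ∈ A from hs ▸ Algebra.subset_adjoin hx')
  have hT'O : T' ≤ OA := Algebra.adjoin_le hσO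
  have hT : T'.toSubring ≤ O.toSubring := fun x hx => hT'O hx
  have hAT : A.toSubring ≤ T'.toSubring := by
    intro x hx
    have hx' : x ∈ Algebra.adjoin k (s : Set K) := hs.symm ▸ hx
    exact Algebra.adjoin_mono (by intro y hy; exact Finset.mem_coe.mpr (Finset.mem_insert_of_mem (Finset.mem_coe.mp hy))) hx'
  have hmax : (subringCentre T'.toSubring O hT).IsMaximal := hzd T'.toSubring hT hAT
  -- the field `T/𝔠` and the surjection from the polynomial ring
  set 𝔠 : Ideal ↥T'.toSubring := subringCentre T'.toSubring O hT with h𝔠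
  letI : Field (↥T'.toSubring ⧸ 𝔠) := @Ideal.Quotient.field _ _ 𝔠 hmax
  have hmemT : ∀ P : MvPolynomial ↥σ k, MvPolynomial.aeval v P ∈ T'.toSubring := fun P => by
    rw [Subalgebra.mem_toSubring, hT'eq]
    exact ⟨P, rfl⟩
  let ψ : MvPolynomial ↥σ k →+* ↥T'.toSubring := (MvPolynomial.aeval v).toRingHom.codRestrict T'.toSubring hmemT
  have hψ : Function.Surjective ψ := by
    intro t
    have ht : (t : K) ∈ (MvPolynomial.aeval (R := k) v).range := by
      rw [← hT'eq]
      exact (Subalgebra.mem_toSubring).mp t.2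
    obtain ⟨P, hP⟩ := ht
    exact ⟨P, Subtype.ext hP⟩
  let g : MvPolynomial ↥σ k →+* (↥T'.toSubring ⧸ 𝔠) := (Ideal.Quotient.mk 𝔠).comp ψ
  have hg : Function.Surjective g := (Ideal.Quotient.mk_surjective).comp hψ
  have hint : (g.comp MvPolynomial.C).IsIntegral := MvPolynomial.comp_C_integral_of_surjective_of_isJacobsonRing g hg
  -- the embedding `T/𝔠 → κ_v`
  let ι₀ : ↥T'.toSubring →+* IsLocalRing.ResidueField O := (IsLocalRing.residue O).comp (Subring.inclusion hT)
  have hι₀ : ∀ a : ↥T'.toSubring, a ∈ 𝔠 → ι₀ a = 0 := by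
    intro a ha
    show IsLocalRing.residue O (Subring.inclusion hT a) = 0
    rw [IsLocalRing.residue_eq_zero_iff]
    rw [h𝔠, subringCentre_eq] at ha
    exact ha
  let ι : (↥T'.toSubring ⧸ 𝔠) →+* IsLocalRing.ResidueField O := Ideal.Quotient.lift 𝔠 ι₀ hι₀
  -- the generator `o` as an element of `T`
  have hoT : o ∈ T'.toSubring := by
    rw [Subalgebra.mem_toSubring]
    exact Algebra.subset_adjoin (Finset.mem_coe.mpr (Finset.mem_insert_self o s))
  have hιo : ι (Ideal.Quotient.mk 𝔠 ⟨o, hoT⟩) = IsLocalRing.residue O ⟨o, ho⟩ := by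
    show ι₀ ⟨o, hoT⟩ = _
    rfl
  have hιgC : (ι.comp (g.comp MvPolynomial.C)) = algebraMap k (IsLocalRing.ResidueField O) := by
    ext c
    show ι (Ideal.Quotient.mk 𝔠 (ψ (MvPolynomial.C c))) = _
    rw [Ideal.Quotient.lift_mk]
    have hψC : ψ (MvPolynomial.C c) = ⟨algebraMap k K c, hAT (A.algebraMap_mem c)⟩ := by
      apply Subtype.ext
      show MvPolynomial.aeval v (MvPolynomial.C c) = algebraMap k K c
      exact MvPolynomial.algHom_C _ c
    rw [hψC, hcomp c (hk c)]
    rfl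
  obtain ⟨P, hPmonic, hP⟩ := hint (Ideal.Quotient.mk 𝔠 ⟨o, hoT⟩)
  refine ⟨P, hPmonic, ?_⟩
  have h1 := congrArg ι hP
  rw [Polynomial.hom_eval₂, map_zero, hιgC, hιo] at h1
  exact h1

/-- **In the :279 regime `κ_v/k` is algebraic** (corollary; `Algebra.IsAlgebraic` for any compatible `k`-algebra structure on `κ_v`). [folklore] -/
theorem isAlgebraic_residueField_of_centres_maximal {k K : Type} [Field k] [Field K] [Algebra k K]
    (O : ValuationSubring K) (A : Subalgebra k K) (hAO : A.toSubring ≤ O.toSubring) (hAfg : A.FG)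
    (hzd : ∀ (T : Subring K) (hT : T ≤ O.toSubring), A.toSubring ≤ T → (subringCentre T O hT).IsMaximal)
    [Algebra k (IsLocalRing.ResidueField O)]
    (hcomp : ∀ (c : k) (h : algebraMap k K c ∈ O),
      algebraMap k (IsLocalRing.ResidueField O) c = IsLocalRing.residue O ⟨algebraMap k K c, h⟩) :
    Algebra.IsAlgebraic k (IsLocalRing.ResidueField O) := by
  have hintegral : Algebra.IsIntegral k (IsLocalRing.ResidueField O) := by
    refine ⟨fun y => ?_⟩
    obtain ⟨x, rfl⟩ := IsLocalRing.residue_surjective y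
    exact residue_isIntegral_of_centres_maximal O A hAO hAfg hzd hcomp x.1 x.2
  exact Algebra.IsIntegral.isAlgebraic

end Summit.ResolutionOfSingularities.ResolutionOfSingularities.Theorems.RadicialJungCleanModels.Lens5TFrame

end
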